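import Summits.QuantumFields.BalabanUV.Beta.D1BFx.PackedCoframeSiteWords
import Summits.QuantumFields.BalabanUV.Beta.D1BFx.PackedPinnedLettersLoc

/-!
# BetaPertH road «BF-x» — «COFRAME-PACK-2» P4a: s-UNIFORM localisation of the packed twisted mixed co-frame table

STATUS: [folklore] `ℓ¹` bookkeeping for the road's (A1)-PACKED identity (BINDER row D1, slot (K), chain step (I)); NOT an estimate of Bałaban's,
NOT a discharge of any root-level binder.  Provenance: reconstruction; the manuscript(s) under audit are NOT citable.

WHAT ((u1) of PART 3b∕PART 4's N-side socket `hWN` for the co-frame half).  For weight families `w` (centre `P`), `w′` (centre `P′`) decaying at a rate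
`0 < δ ≤ dB (m+1) a∕8`, the bond kernels of the computed words of P2's expansion (`k9 k5 k7 k4`, packed into `cofPair`; their torus identities are P3b's
`T•` and P3c) are bi-localised at `(P, P′)` with ONE constant and ONE rate for ALL periods `s = (m+1)·p`:
* §0 [our objects] `k9`, `k5`, `k7`, `k4`, **`cofPair := 2•(trK k9 + trK (k7 w′ w) + trK (k7 w w′) + k4 + k5 + trK k5 + k7 w w′ + k7 w′ w + k9)`**.
* §1 [our object] the bookkeeping predicate `ULoc m F P Q := ∃ K θ, 0 < θ ∧ ∀ p, BiLoc (F ((m+1)·p)) P Q K θ` and [folklore] its algebra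
  `uloc_add`, `uloc_neg`, `uloc_sub`, `uloc_smul`, `uloc_trK`, `uloc_recentre`, `uloc_loc`, `uloc_exists_biLoc`.
* §2 [folklore] the four sandwich shapes: `uloc_dSw`, `uloc_jetCw_arr`, `uloc_jetRw_arr`, `uloc_jetCw_mul_perW_Rgt`, `uloc_jetRCw_perW_Rgt`.
* §3 [folklore] `uloc_k9`, `uloc_k5`, `uloc_k7`, `uloc_k4`, **`uloc_cofPair`**, and the road's form
  **`biLoc_cofPair_uniform : ∃ CN δN, 0 ≤ CN ∧ 0 < δN ∧ ∀ p, BiLoc (cofPair ((m+1)·p) (m+1) a w w′) P P′ CN δN`**.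
Unit `b2b-balaban-beta-d1-formalise-leaf-03` (gen 23); road owner `b2b-balaban-beta-d1-p2` (W-d1p2-g18-4∕-5, journal l.40583).
-/

noncomputable section

namespace Summit.QuantumFields.BalabanUV.Beta.D1BFx.PackedCoframePairLoc

open scoped BigOperators
open Literature.MathematicalPhysics.QuantumFieldTheory.Balaban1983to89
open Literature.MathematicalPhysics.QuantumFieldTheory.Balaban1983to89.Beta
open B12Sec2to5 (l1 l1_nonneg)
open ExpKernelCalculus (MKer BiLoc Decays comp Zl Zl_pos Zl_nonneg)
open KernelWard (biLoc_recentre biLoc_add)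
open Summit.QuantumFields.BalabanUV.Beta.TameKernelCalculus (Loc decays_of_le biLoc_of_le trK biLoc_trK)
open Summit.QuantumFields.BalabanUV.Beta.D1BFx.PeriodicArrays (arr decays_arr)
open Summit.QuantumFields.BalabanUV.Beta.D1BFx.RJetProjector (Rgt)
open Summit.QuantumFields.BalabanUV.Beta.D1BFx.RJetAssembly (dSw biLoc_dSw)
open Summit.QuantumFields.BalabanUV.Beta.D1BFx.KGhostLeg (Cgh)
open Summit.QuantumFields.BalabanUV.Beta.D1BFx.GhostStencil (l1_zero)
open Summit.QuantumFields.BalabanUV.Beta.D1BFx.TorusGhostWordArrays (lapU)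
open Summit.QuantumFields.BalabanUV.Beta.D1BFx.TorusBondArrays (dB dB_pos)
open Summit.QuantumFields.BalabanUV.Beta.D1BFx.TorusWeightWordArrays (decays_Rgt_dB)
open Summit.QuantumFields.BalabanUV.Beta.D1BFx.PackedPinnedLetters (jetRw jetCw jetRCw)
open Summit.QuantumFields.BalabanUV.Beta.D1BFx.PackedPinnedLettersLoc (biLoc_jetRw_of_decays biLoc_jetCw_of_decays biLoc_jetRCw_of_decays)
open Summit.QuantumFields.BalabanUV.Beta.D1BFx.PackedCoframeSiteWords (perW gW qW d2W l2W biLoc_LC_gW biLoc_gW_CL biLoc_LC_d2W biLoc_LC_qW_CL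
  biLoc_LC_qW_Cgh_arr_gW biLoc_gW_Cgh_arr_gW biLoc_LC_l2W_CL biLoc_LC_qW_Cgh_arr_qW_CL)

/-! ## §0 The bond kernels of the computed words -/

section KernelDefs

variable (s : ℕ) (n : ℕ) [NeZero n] (a : ℝ) (w w' : Fin 4 → (Fin 4 → ℤ) → ℝ)

/-- [our object] **THE KERNEL OF W9 = `M̂₀ᵀĈM̂₂`** at packed jets (weights `w = wₛ`, `w′ = wₜ`):
`dSw ((lapU∘Cgh)∘d2W w (perW s w′)) − jetCw w′ (arr s ((lapU∘Cgh)∘gW w)) − jetCw w (arr s ((lapU∘Cgh)∘gW w′)) + jetCw (w·perW s w′) Rgt`. A definition. -/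
def k9 : MKer 4 (Fin 4) :=
  dSw (comp (comp lapU (Cgh n a)) (d2W w (perW s w'))) - jetCw w' (arr s (comp (comp lapU (Cgh n a)) (gW w)))
    - jetCw w (arr s (comp (comp lapU (Cgh n a)) (gW w'))) + jetCw (fun κ u => w κ u * perW s w' κ u) (Rgt n a)

/-- [our object] **THE KERNEL OF W5 = `−M̂ₛᵀĈM̂ₜ`**:
`dSw ((gW w∘Cgh)∘arr s (gW w′)) − jetCw w′ (arr s (gW w∘(Cgh∘lapU))) + jetRw w (arr s ((lapU∘Cgh)∘gW w′)) − jetRCw w (perW s w′) Rgt`. A definition. -/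
def k5 : MKer 4 (Fin 4) :=
  dSw (comp (comp (gW w) (Cgh n a)) (arr s (gW w'))) - jetCw w' (arr s (comp (gW w) (comp (Cgh n a) lapU)))
    + jetRw w (arr s (comp (comp lapU (Cgh n a)) (gW w'))) - jetRCw w (perW s w') (Rgt n a)

/-- [our object] **THE KERNEL OF W7 = `M̂₀ᵀĈ_wM̂_{w′}`** (the `L̂²`-word from `w`, the co-frame jet from `w′`):
`−dSw ((((lapU∘Cgh)∘qW w)∘Cgh)∘arr s (gW w′)) + jetCw w′ (arr s (((lapU∘Cgh)∘qW w)∘(Cgh∘lapU)))`. A definition. -/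
def k7 : MKer 4 (Fin 4) :=
  -dSw (comp (comp (comp (comp lapU (Cgh n a)) (qW w)) (Cgh n a)) (arr s (gW w')))
    + jetCw w' (arr s (comp (comp (comp lapU (Cgh n a)) (qW w)) (comp (Cgh n a) lapU)))

/-- [our object] **THE KERNEL OF W4 = `M̂₀ᵀĈ₂M̂₀`**:
`−dSw (((lapU∘Cgh)∘l2W s w w′)∘(Cgh∘lapU)) + dSw (((((lapU∘Cgh)∘qW w)∘Cgh)∘arr s (qW w′))∘(Cgh∘lapU)) + (w ↔ w′)`. A definition. -/
def k4 : MKer 4 (Fin 4) :=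
  -dSw (comp (comp (comp lapU (Cgh n a)) (l2W s w w')) (comp (Cgh n a) lapU))
    + dSw (comp (comp (comp (comp (comp lapU (Cgh n a)) (qW w)) (Cgh n a)) (arr s (qW w'))) (comp (Cgh n a) lapU))
    + dSw (comp (comp (comp (comp (comp lapU (Cgh n a)) (qW w')) (Cgh n a)) (arr s (qW w))) (comp (Cgh n a) lapU))

/-- [our object] **THE PACKED TWISTED MIXED CO-FRAME WEIGHT TABLE** `𝒲cof_s` (the nine words in P2's order, W1 = W9ᵀ, W2 = W8ᵀ, W3 = W7ᵀ, W6 = W5ᵀ):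
`cofPair := 2 • (trK k9 + trK (k7 w′ w) + trK (k7 w w′) + k4 + k5 + trK k5 + k7 w w′ + k7 w′ w + k9)`. A definition; asserts nothing. -/
def cofPair : MKer 4 (Fin 4) :=
  (2 : ℝ) • (trK (k9 s n a w w') + trK (k7 s n a w' w) + trK (k7 s n a w w') + k4 s n a w w' + k5 s n a w w' + trK (k5 s n a w w')
    + k7 s n a w w' + k7 s n a w' w + k9 s n a w w')

end KernelDefs

/-! ## §1 Uniform localisation along the road's tori -/

section ULoc

/-- [our object] **s-UNIFORM BI-LOCALISATION** of an `s`-indexed bond-kernel family along the tori `s = (m+1)·p`: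
one constant, one positive rate, all `p` (the bookkeeping predicate of this file, like `TameKernelCalculus.Loc`; asserts nothing by itself). -/
def ULoc (m : ℕ) (F : ℕ → MKer 4 (Fin 4)) (P Q : Fin 4 → ℤ) : Prop :=
  ∃ K θ : ℝ, 0 < θ ∧ ∀ (p : ℕ) [NeZero p], BiLoc (F ((m + 1) * p)) P Q K θ

variable {m : ℕ} {F G : ℕ → MKer 4 (Fin 4)} {P Q : Fin 4 → ℤ}

/-- [folklore] Sum. -/
theorem uloc_add (hF : ULoc m F P Q) (hG : ULoc m G P Q) : ULoc m (fun s => F s + G s) P Q := by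
  obtain ⟨K, θ, hθ, h⟩ := hF
  obtain ⟨K', θ', hθ', h'⟩ := hG
  refine ⟨K + K', min θ θ', lt_min hθ hθ', fun p _ => biLoc_add ?_ ?_⟩
  · exact StepJetData.biLoc_weaken (h p) le_rfl (min_le_left _ _)
  · exact StepJetData.biLoc_weaken (h' p) le_rfl (min_le_right _ _)

/-- [folklore] Negation. -/
theorem uloc_neg (hF : ULoc m F P Q) : ULoc m (fun s => -F s) P Q := by
  obtain ⟨K, θ, hθ, h⟩ := hF
  exact ⟨K, θ, hθ, fun p _ => SecondOrderResponse.biLoc_neg (h p)⟩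

/-- [folklore] Difference. -/
theorem uloc_sub (hF : ULoc m F P Q) (hG : ULoc m G P Q) : ULoc m (fun s => F s - G s) P Q := by
  have h := uloc_add hF (uloc_neg hG)
  simpa only [sub_eq_add_neg] using h

/-- [folklore] Scalar multiple. -/
theorem uloc_smul (c : ℝ) (hF : ULoc m F P Q) : ULoc m (fun s => c • F s) P Q := by
  obtain ⟨K, θ, hθ, h⟩ := hF
  exact ⟨|c| * K, θ, hθ, fun p _ => StepJetData.biLoc_smul (h p) c⟩

/-- [folklore] Transpose (centres exchanged). -/
theorem uloc_trK (hF : ULoc m F P Q) : ULoc m (fun s => trK (F s)) Q P := by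
  obtain ⟨K, θ, hθ, h⟩ := hF
  exact ⟨K, θ, hθ, fun p _ => biLoc_trK (h p)⟩

/-- [folklore] Re-centring (the constant absorbs `e^{θ(|P−P₁|₁+|Q−Q₁|₁)}`). -/
theorem uloc_recentre (hF : ULoc m F P Q) (P₁ Q₁ : Fin 4 → ℤ) : ULoc m F P₁ Q₁ := by
  obtain ⟨K, θ, hθ, h⟩ := hF
  exact ⟨_, θ, hθ, fun p _ => biLoc_recentre (h p) hθ.le P₁ Q₁⟩

/-- [folklore] Each member of a uniformly localised family is `Loc`. -/
theorem uloc_loc (hF : ULoc m F P Q) (p : ℕ) [NeZero p] : Loc (F ((m + 1) * p)) := by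
  obtain ⟨K, θ, hθ, h⟩ := hF
  exact ⟨P, Q, K, θ, hθ, h p⟩

/-- [folklore] The road's currency: one constant `CN ≥ 0` and one rate `δN > 0` for all `p`. -/
theorem uloc_exists_biLoc (hF : ULoc m F P Q) :
    ∃ CN δN : ℝ, 0 ≤ CN ∧ 0 < δN ∧ ∀ (p : ℕ) [NeZero p], BiLoc (F ((m + 1) * p)) P Q CN δN := by
  obtain ⟨K, θ, hθ, h⟩ := hF
  exact ⟨K, θ, (h 1).nonneg 0, hθ, h⟩

end ULoc

/-! ## §2 The four sandwich shapes -/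

section Shapes

variable {m : ℕ} {Z : ℕ → MKer 4 Unit} {v : Fin 4 → (Fin 4 → ℤ) → ℝ} {Cv δ θ : ℝ} {P Pv : Fin 4 → ℤ}

/-- [folklore] **`dSw`**: a family of site kernels uniformly localised at `(P,P)` gives `ULoc m (dSw ∘ Z) P P` (`RJetAssembly.biLoc_dSw`). -/
theorem uloc_dSw (hZ : ∃ K : ℝ, 0 ≤ K ∧ ∀ (s : ℕ) [NeZero s], BiLoc (Z s) P P K θ) (hθ : 0 < θ) :
    ULoc m (fun s => dSw (Z s)) P P := by
  obtain ⟨K, -, hK⟩ := hZ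
  exact ⟨_, θ, hθ, fun p _ => biLoc_dSw _ _ hθ.le (hK ((m + 1) * p))⟩

/-- [folklore] **`jetCw v (arr s Z)`**: a decaying weight `v` (centre `Pv`, rate `δ`) on the column and the array of a uniformly localised `Z` inside
⟹ `ULoc m (jetCw v (arr s (Z s))) Pv Pv` (P1b `biLoc_jetCw_of_decays` at the common rate `min δ (θ∕2)`; `decays_arr` is `s`-free). -/
theorem uloc_jetCw_arr (hv : ∀ κ u, |v κ u| ≤ Cv * Real.exp (-δ * l1 (u - Pv))) (hδ : 0 < δ)
    (hZ : ∃ K : ℝ, 0 ≤ K ∧ ∀ (s : ℕ) [NeZero s], BiLoc (Z s) P P K θ) (hθ : 0 < θ) :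
    ULoc m (fun s => jetCw v (arr s (Z s))) Pv Pv := by
  obtain ⟨K, hK0, hK⟩ := hZ
  have hm : 0 < min δ (θ / 2) := lt_min hδ (half_pos hθ)
  have hY : ∀ (p : ℕ) [NeZero p], Decays (arr ((m + 1) * p) (Z ((m + 1) * p))) (K * Zl 4 (θ / 2)) (min δ (θ / 2)) := fun p _ => by
    have h := decays_arr (hK ((m + 1) * p)) hθ ((m + 1) * p)
    rw [sub_self, l1_zero, mul_zero, Real.exp_zero, mul_one] at h
    exact StepJetData.decays_weaken h le_rfl (min_le_right _ _)
  exact ⟨_, min δ (θ / 2) / 2, half_pos hm, fun p _ => biLoc_jetCw_of_decays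
    (fun β z => PeriodicArrayWrapLimit.weight_mono (hv β) (min_le_left _ _) z) (hY p) hm.le⟩

/-- [folklore] **`jetRw v (arr s Z)`** (the weight on the row). -/
theorem uloc_jetRw_arr (hv : ∀ κ u, |v κ u| ≤ Cv * Real.exp (-δ * l1 (u - Pv))) (hδ : 0 < δ)
    (hZ : ∃ K : ℝ, 0 ≤ K ∧ ∀ (s : ℕ) [NeZero s], BiLoc (Z s) P P K θ) (hθ : 0 < θ) :
    ULoc m (fun s => jetRw v (arr s (Z s))) Pv Pv := by
  obtain ⟨K, hK0, hK⟩ := hZ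
  have hm : 0 < min δ (θ / 2) := lt_min hδ (half_pos hθ)
  have hY : ∀ (p : ℕ) [NeZero p], Decays (arr ((m + 1) * p) (Z ((m + 1) * p))) (K * Zl 4 (θ / 2)) (min δ (θ / 2)) := fun p _ => by
    have h := decays_arr (hK ((m + 1) * p)) hθ ((m + 1) * p)
    rw [sub_self, l1_zero, mul_zero, Real.exp_zero, mul_one] at h
    exact StepJetData.decays_weaken h le_rfl (min_le_right _ _)
  exact ⟨_, min δ (θ / 2) / 2, half_pos hm, fun p _ => biLoc_jetRw_of_decays
    (fun β z => PeriodicArrayWrapLimit.weight_mono (hv β) (min_le_left _ _) z) (hY p) hm.le⟩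

variable {a : ℝ} {w w' : Fin 4 → (Fin 4 → ℤ) → ℝ} {C C' : ℝ} {P' : Fin 4 → ℤ}

/-- [folklore] The product weight `w · perW s w′` decays from `P` like `w`, with the `s`-free constant `C·(C′·Zl 4 δ)`. -/
theorem abs_mul_perW_le (hw : ∀ κ u, |w κ u| ≤ C * Real.exp (-δ * l1 (u - P))) (hw' : ∀ κ u, |w' κ u| ≤ C' * Real.exp (-δ * l1 (u - P')))
    (hδ : 0 < δ) (s : ℕ) [NeZero s] (κ : Fin 4) (u : Fin 4 → ℤ) :
    |w κ u * perW s w' κ u| ≤ C * (C' * Zl 4 δ) * Real.exp (-δ * l1 (u - P)) := by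
  rw [abs_mul]
  have h1 := hw κ u
  have h2 : |perW s w' κ u| ≤ C' * Zl 4 δ := PeriodicArrayWrapLimit.abs_tsum_images_le (hw' κ) hδ s u
  have hC : 0 ≤ C := PeriodicArrayWrapLimit.const_nonneg_of_weight (hw 0)
  calc |w κ u| * |perW s w' κ u| ≤ (C * Real.exp (-δ * l1 (u - P))) * (C' * Zl 4 δ) :=
        mul_le_mul h1 h2 (abs_nonneg _) (mul_nonneg hC (Real.exp_pos _).le)
    _ = C * (C' * Zl 4 δ) * Real.exp (-δ * l1 (u - P)) := by ring

/-- [folklore] **`jetCw (w · perW s w′) Rgt`**: `ULoc m _ P P` (`Rgt` decays at `dB/8 ≥ δ`). -/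
theorem uloc_jetCw_mul_perW_Rgt (ha : 0 < a) (hw : ∀ κ u, |w κ u| ≤ C * Real.exp (-δ * l1 (u - P)))
    (hw' : ∀ κ u, |w' κ u| ≤ C' * Real.exp (-δ * l1 (u - P'))) (hδ : 0 < δ) (hδB : δ ≤ dB (m + 1) a / 8) :
    ULoc m (fun s => jetCw (fun κ u => w κ u * perW s w' κ u) (Rgt (m + 1) a)) P P :=
  ⟨_, δ / 2, half_pos hδ, fun p _ => biLoc_jetCw_of_decays (fun β z => abs_mul_perW_le hw hw' hδ ((m + 1) * p) β z)
    (decays_of_le (decays_Rgt_dB m ha) hδB) hδ.le⟩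

/-- [folklore] **`jetRCw w (perW s w′) Rgt`**: `ULoc m _ P P` (the periodised second weight is merely BOUNDED, by `C′·Zl 4 δ`). -/
theorem uloc_jetRCw_perW_Rgt (ha : 0 < a) (hw : ∀ κ u, |w κ u| ≤ C * Real.exp (-δ * l1 (u - P)))
    (hw' : ∀ κ u, |w' κ u| ≤ C' * Real.exp (-δ * l1 (u - P'))) (hδ : 0 < δ) (hδB : δ ≤ dB (m + 1) a / 8) :
    ULoc m (fun s => jetRCw w (perW s w') (Rgt (m + 1) a)) P P :=
  ⟨_, δ / 2, half_pos hδ, fun p _ => biLoc_jetRCw_of_decays hw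
    (fun β z => PeriodicArrayWrapLimit.abs_tsum_images_le (hw' β) hδ ((m + 1) * p) z) (decays_of_le (decays_Rgt_dB m ha) hδB) hδ.le⟩

end Shapes

/-! ## §3 The kernels of P3b -/

section Kernels

variable (m : ℕ) {a : ℝ} {w w' : Fin 4 → (Fin 4 → ℤ) → ℝ} {C C' δ : ℝ} {P P' : Fin 4 → ℤ}
  (ha : 0 < a) (hw : ∀ κ u, |w κ u| ≤ C * Real.exp (-δ * l1 (u - P))) (hw' : ∀ κ u, |w' κ u| ≤ C' * Real.exp (-δ * l1 (u - P')))
  (hδ : 0 < δ) (hδB : δ ≤ dB (m + 1) a / 8)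
include ha hw hw' hδ hδB

omit ha hw hw' hδ hδB in
/-- [folklore] A localisation that does not depend on `s` is in particular uniform in `s`. -/
theorem const_family {Z : MKer 4 Unit} {θ : ℝ} (h : ∃ K : ℝ, 0 ≤ K ∧ BiLoc Z P P K θ) :
    ∃ K : ℝ, 0 ≤ K ∧ ∀ (s : ℕ) [NeZero s], BiLoc ((fun _ : ℕ => Z) s) P P K θ := by
  obtain ⟨K, h0, hK⟩ := h
  exact ⟨K, h0, fun _ _ => hK⟩

omit ha hw hw' hδ hδB in
/-- [folklore] **`ULoc m (k9 · (m+1) a w w′) P P′`**. -/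
theorem uloc_k9 (ha : 0 < a) (hw : ∀ κ u, |w κ u| ≤ C * Real.exp (-δ * l1 (u - P)))
    (hw' : ∀ κ u, |w' κ u| ≤ C' * Real.exp (-δ * l1 (u - P'))) (hδ : 0 < δ) (hδB : δ ≤ dB (m + 1) a / 8) :
    ULoc m (fun s => k9 s (m + 1) a w w') P P' := by
  have h1 : ULoc m (fun s => dSw (comp (comp lapU (Cgh (m + 1) a)) (d2W w (perW s w')))) P P :=
    uloc_dSw (biLoc_LC_d2W m ha hw hw' hδ hδB) (by linarith)
  have h2 : ULoc m (fun s => jetCw w' (arr s (comp (comp lapU (Cgh (m + 1) a)) (gW w)))) P' P' :=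
    uloc_jetCw_arr hw' hδ (const_family (biLoc_LC_gW m ha hw hδ hδB)) (by linarith)
  have h3 : ULoc m (fun s => jetCw w (arr s (comp (comp lapU (Cgh (m + 1) a)) (gW w')))) P P :=
    uloc_jetCw_arr hw hδ (const_family (biLoc_LC_gW m ha hw' hδ hδB)) (by linarith)
  have h4 := uloc_jetCw_mul_perW_Rgt (m := m) ha hw hw' hδ hδB
  exact uloc_add (uloc_sub (uloc_sub (uloc_recentre h1 P P') (uloc_recentre h2 P P')) (uloc_recentre h3 P P')) (uloc_recentre h4 P P')

omit ha hw hw' hδ hδB in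
/-- [folklore] **`ULoc m (k5 · (m+1) a w w′) P P′`**. -/
theorem uloc_k5 (ha : 0 < a) (hw : ∀ κ u, |w κ u| ≤ C * Real.exp (-δ * l1 (u - P)))
    (hw' : ∀ κ u, |w' κ u| ≤ C' * Real.exp (-δ * l1 (u - P'))) (hδ : 0 < δ) (hδB : δ ≤ dB (m + 1) a / 8) :
    ULoc m (fun s => k5 s (m + 1) a w w') P P' := by
  have h1 : ULoc m (fun s => dSw (comp (comp (gW w) (Cgh (m + 1) a)) (arr s (gW w')))) P P :=
    uloc_dSw (biLoc_gW_Cgh_arr_gW m ha hw hw' hδ hδB) (by linarith)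
  have h2 : ULoc m (fun s => jetCw w' (arr s (comp (gW w) (comp (Cgh (m + 1) a) lapU)))) P' P' :=
    uloc_jetCw_arr hw' hδ (const_family (biLoc_gW_CL m ha hw hδ hδB)) (by linarith)
  have h3 : ULoc m (fun s => jetRw w (arr s (comp (comp lapU (Cgh (m + 1) a)) (gW w')))) P P :=
    uloc_jetRw_arr hw hδ (const_family (biLoc_LC_gW m ha hw' hδ hδB)) (by linarith)
  have h4 := uloc_jetRCw_perW_Rgt (m := m) ha hw hw' hδ hδB
  exact uloc_sub (uloc_add (uloc_sub (uloc_recentre h1 P P') (uloc_recentre h2 P P')) (uloc_recentre h3 P P')) (uloc_recentre h4 P P')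

omit ha hw hw' hδ hδB in
/-- [folklore] **`ULoc m (k7 · (m+1) a w w′) P P′`**. -/
theorem uloc_k7 (ha : 0 < a) (hw : ∀ κ u, |w κ u| ≤ C * Real.exp (-δ * l1 (u - P)))
    (hw' : ∀ κ u, |w' κ u| ≤ C' * Real.exp (-δ * l1 (u - P'))) (hδ : 0 < δ) (hδB : δ ≤ dB (m + 1) a / 8) :
    ULoc m (fun s => k7 s (m + 1) a w w') P P' := by
  have h1 : ULoc m (fun s => dSw (comp (comp (comp (comp lapU (Cgh (m + 1) a)) (qW w)) (Cgh (m + 1) a)) (arr s (gW w')))) P P :=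
    uloc_dSw (biLoc_LC_qW_Cgh_arr_gW m ha hw hw' hδ hδB) (by linarith)
  have h2 : ULoc m (fun s => jetCw w' (arr s (comp (comp (comp lapU (Cgh (m + 1) a)) (qW w)) (comp (Cgh (m + 1) a) lapU)))) P' P' :=
    uloc_jetCw_arr hw' hδ (const_family (biLoc_LC_qW_CL m ha hw hδ hδB)) (by linarith)
  exact uloc_add (uloc_neg (uloc_recentre h1 P P')) (uloc_recentre h2 P P')

omit ha hw hw' hδ hδB in
/-- [folklore] **`ULoc m (k4 · (m+1) a w w′) P P′`**. -/
theorem uloc_k4 (ha : 0 < a) (hw : ∀ κ u, |w κ u| ≤ C * Real.exp (-δ * l1 (u - P)))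
    (hw' : ∀ κ u, |w' κ u| ≤ C' * Real.exp (-δ * l1 (u - P'))) (hδ : 0 < δ) (hδB : δ ≤ dB (m + 1) a / 8) :
    ULoc m (fun s => k4 s (m + 1) a w w') P P' := by
  have h1 : ULoc m (fun s => dSw (comp (comp (comp lapU (Cgh (m + 1) a)) (l2W s w w')) (comp (Cgh (m + 1) a) lapU))) P P :=
    uloc_dSw (biLoc_LC_l2W_CL m ha hw hw' hδ hδB) (by linarith)
  have h2 : ULoc m (fun s => dSw (comp (comp (comp (comp (comp lapU (Cgh (m + 1) a)) (qW w)) (Cgh (m + 1) a)) (arr s (qW w')))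
      (comp (Cgh (m + 1) a) lapU))) P P :=
    uloc_dSw (biLoc_LC_qW_Cgh_arr_qW_CL m ha hw hw' hδ hδB) (by linarith)
  have h3 : ULoc m (fun s => dSw (comp (comp (comp (comp (comp lapU (Cgh (m + 1) a)) (qW w')) (Cgh (m + 1) a)) (arr s (qW w)))
      (comp (Cgh (m + 1) a) lapU))) P' P' :=
    uloc_dSw (biLoc_LC_qW_Cgh_arr_qW_CL m ha hw' hw hδ hδB) (by linarith)
  exact uloc_add (uloc_add (uloc_neg (uloc_recentre h1 P P')) (uloc_recentre h2 P P')) (uloc_recentre h3 P P')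

omit ha hw hw' hδ hδB in
/-- [folklore] **(u1) FOR THE CO-FRAME HALF — `ULoc m (cofPair · (m+1) a w w′) P P′`**: the packed twisted mixed co-frame table is bi-localised at the
weights' centres with one constant and one rate for every torus of the road's family. -/
theorem uloc_cofPair (ha : 0 < a) (hw : ∀ κ u, |w κ u| ≤ C * Real.exp (-δ * l1 (u - P)))
    (hw' : ∀ κ u, |w' κ u| ≤ C' * Real.exp (-δ * l1 (u - P'))) (hδ : 0 < δ) (hδB : δ ≤ dB (m + 1) a / 8) :
    ULoc m (fun s => cofPair s (m + 1) a w w') P P' := by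
  have h9 := uloc_k9 m ha hw hw' hδ hδB
  have h5 := uloc_k5 m ha hw hw' hδ hδB
  have h7 := uloc_k7 m ha hw hw' hδ hδB
  have h8 := uloc_k7 m ha hw' hw hδ hδB
  have h4 := uloc_k4 m ha hw hw' hδ hδB
  exact uloc_smul 2 (uloc_add (uloc_add (uloc_add (uloc_add (uloc_add (uloc_add (uloc_add (uloc_add
    (uloc_recentre (uloc_trK h9) P P') (uloc_recentre (uloc_trK h8) P P')) (uloc_recentre (uloc_trK h7) P P')) h4) h5)
    (uloc_recentre (uloc_trK h5) P P')) h7) (uloc_recentre h8 P P')) h9)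

omit ha hw hw' hδ hδB in
/-- [folklore] **(u1) IN THE ROAD's CURRENCY**: `∃ CN δN, 0 ≤ CN ∧ 0 < δN ∧ ∀ p, BiLoc (cofPair ((m+1)·p) (m+1) a w w′) P P′ CN δN`. -/
theorem biLoc_cofPair_uniform (ha : 0 < a) (hw : ∀ κ u, |w κ u| ≤ C * Real.exp (-δ * l1 (u - P)))
    (hw' : ∀ κ u, |w' κ u| ≤ C' * Real.exp (-δ * l1 (u - P'))) (hδ : 0 < δ) (hδB : δ ≤ dB (m + 1) a / 8) :
    ∃ CN δN : ℝ, 0 ≤ CN ∧ 0 < δN ∧ ∀ (p : ℕ) [NeZero p], BiLoc (cofPair ((m + 1) * p) (m + 1) a w w') P P' CN δN :=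
  uloc_exists_biLoc (uloc_cofPair m ha hw hw' hδ hδB)

omit ha hw hw' hδ hδB in
/-- [folklore] Each `cofPair ((m+1)·p) (m+1) a w w′` is `Loc` (the currency of `TorusMixedLetters.hat_arr_add_loc`). -/
theorem loc_cofPair (ha : 0 < a) (hw : ∀ κ u, |w κ u| ≤ C * Real.exp (-δ * l1 (u - P)))
    (hw' : ∀ κ u, |w' κ u| ≤ C' * Real.exp (-δ * l1 (u - P'))) (hδ : 0 < δ) (hδB : δ ≤ dB (m + 1) a / 8) (p : ℕ) [NeZero p] :
    Loc (cofPair ((m + 1) * p) (m + 1) a w w') :=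
  uloc_loc (uloc_cofPair m ha hw hw' hδ hδB) p

end Kernels

end Summit.QuantumFields.BalabanUV.Beta.D1BFx.PackedCoframePairLoc

end
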